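import Mathlib
import Summits.Ventures.PercRepro.TriangleCapFourTable
import Summits.Ventures.PercRepro.TriangleCapThreeRowSecondBestCherries

/-!
# PercRepro — THE STABILITY TABLE OF EVERY ROW `a ≥ 4` IN THE CHERRY FORM (p3, gen 49; part 207)

`Σ d² = 2 · cherries + 2 m` (`sum_deg_sq_le_iff_cherries`, `sum_deg_sq_eq_iff_cherries`) turns `stab_table_rows_ge_four`
and `cherry_second_best_all` into statements about the number of cherries (paths of length two): on the cell `(k, a, r)`,
`a ≥ 4`, `2 a + r ≤ k`, `2 a + 2 ≤ k`, every non-`a`-bipartite `K₄⁻`-free graph with `m + r = a (k − a)` edges has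
`2 · cherries + r (k − 1 − r) + stabGapFull k a r ≤ m (k − 2)`, attained; and for `r ≥ 3` the second best among all
graphs is the broom value `2 (r − 2)`. Axioms: standard.
-/

namespace PercRepro

namespace TriangleCap

namespace C047

open Finset

/-- **THE WHOLE STABILITY TABLE FOR EVERY ROW `a ≥ 4`, CHERRY FORM:** `2 · cherries + r (k − 1 − r) + stabGapFull k a r
≤ m (k − 2)` for every non-`a`-bipartite `K₄⁻`-free graph with `m + r = a (k − a)` edges, `2 a + r ≤ k`, `2 a + 2 ≤ k`;
attained. -/
theorem stab_table_rows_ge_four_cherries (k a r : ℕ) (ha4 : 4 ≤ a) (hk : 2 * a + r ≤ k) (hk2 : 2 * a + 2 ≤ k) :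
    (∀ (D : SimpleGraph (Fin k)) [DecidableRel D.Adj], K4mFree D → D.edgeFinset.card + r = a * (k - a) →
        (¬ ∃ A : Finset (Fin k), A.card = a ∧ BipSub D A) →
        2 * cherries D + r * (k - 1 - r) + stabGapFull k a r ≤ D.edgeFinset.card * (k - 2)) ∧
      ∃ (D : SimpleGraph (Fin k)) (_ : DecidableRel D.Adj), K4mFree D ∧ D.edgeFinset.card + r = a * (k - a) ∧
        (¬ ∃ A : Finset (Fin k), A.card = a ∧ BipSub D A) ∧
        2 * cherries D + r * (k - 1 - r) + stabGapFull k a r = D.edgeFinset.card * (k - 2) := by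
  have hcard : Fintype.card (Fin k) = k := Fintype.card_fin k
  obtain ⟨h1, D, inst, hK, hE, hnb, hS⟩ := stab_table_rows_ge_four k a r ha4 hk hk2
  refine ⟨?_, D, inst, hK, hE, hnb, ?_⟩
  · intro D _ hK hm hnb
    have h := h1 D hK hm hnb
    have := (sum_deg_sq_le_iff_cherries D (r * (k - 1 - r) + stabGapFull k a r) (by rw [hcard]; omega)).mp
      (by rw [hcard]; rw [← add_assoc]; exact h)
    rw [hcard] at this
    rw [add_assoc]
    exact this
  · have := (sum_deg_sq_eq_iff_cherries D (r * (k - 1 - r) + stabGapFull k a r) (by rw [hcard]; omega)).mp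
      (by rw [hcard]; rw [← add_assoc]; exact hS)
    rw [hcard] at this
    rw [add_assoc]
    exact this

/-- **THE SECOND BEST AMONG ALL GRAPHS FOR EVERY ROW `a ≥ 4`, `r ≥ 3`, CHERRY FORM:** `2 · cherries + r (k − 1 − r)
≠ m (k − 2)` forces `2 · cherries + r (k − 1 − r) + 2 (r − 2) ≤ m (k − 2)`; attained. -/
theorem cherry_second_best_all_cherries (k a r : ℕ) (ha4 : 4 ≤ a) (hr3 : 3 ≤ r) (hk : 2 * a + r ≤ k) :
    (∀ (D : SimpleGraph (Fin k)) [DecidableRel D.Adj], K4mFree D → D.edgeFinset.card + r = a * (k - a) →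
        2 * cherries D + r * (k - 1 - r) ≠ D.edgeFinset.card * (k - 2) →
        2 * cherries D + r * (k - 1 - r) + 2 * (r - 2) ≤ D.edgeFinset.card * (k - 2)) ∧
      ∃ (D : SimpleGraph (Fin k)) (_ : DecidableRel D.Adj), K4mFree D ∧ D.edgeFinset.card + r = a * (k - a) ∧
        2 * cherries D + r * (k - 1 - r) + 2 * (r - 2) = D.edgeFinset.card * (k - 2) := by
  have hcard : Fintype.card (Fin k) = k := Fintype.card_fin k
  obtain ⟨h1, D, inst, hK, hE, hS⟩ := cherry_second_best_all k a r ha4 hr3 hk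
  refine ⟨?_, D, inst, hK, hE, ?_⟩
  · intro D _ hK hm hne
    have hne' : ∑ v, deg D v * deg D v + r * (k - 1 - r) ≠ D.edgeFinset.card * k := by
      intro heq
      apply hne
      have := (sum_deg_sq_eq_iff_cherries D (r * (k - 1 - r)) (by rw [hcard]; omega)).mp (by rw [hcard]; exact heq)
      rw [hcard] at this
      exact this
    have h := h1 D hK hm hne'
    have := (sum_deg_sq_le_iff_cherries D (r * (k - 1 - r) + 2 * (r - 2)) (by rw [hcard]; omega)).mp
      (by rw [hcard]; rw [← add_assoc]; exact h)
    rw [hcard] at this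
    rw [add_assoc]
    exact this
  · have := (sum_deg_sq_eq_iff_cherries D (r * (k - 1 - r) + 2 * (r - 2)) (by rw [hcard]; omega)).mp
      (by rw [hcard]; rw [← add_assoc]; exact hS)
    rw [hcard] at this
    rw [add_assoc]
    exact this

end C047

end TriangleCap

end PercRepro
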